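import Summits.ResolutionOfSingularities.ResolutionOfSingularities.Theorems.ValuativeTorsorToLurel
import Summits.ResolutionOfSingularities.ResolutionOfSingularities.Theorems.ValuativeTorsorToLurelFfinite

/-!
# `Valuative.TorsorToLurel` modulo Temkin's inseparable local uniformization theorem

Route `ResolutionOfSingularities/Valuative`, crux `TorsorToLurel`
(stmt-ResolutionOfSingularities-10968). CONDITIONAL corollaries of the unconditional transfer
`torsorToLurel_of_torsorToLurelFfinite` (`ValuativeTorsorToLurel.lean`) through the in-tree
conditional discharge of the `F`-finite sibling
(`torsorToLurelFfinite_of_temkin2013Relative`, `torsorToLurelFfinite_of_smoothFibre`): the crux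
holds modulo Temkin's theorem (Temkin 2013 = arXiv:0804.1554v3, Thm. 1.3.2, relative form,
corrected rendering `Temkin2013Relative`), i.e. modulo the single remaining leaf
`Temkin2013RelativeCurveSmoothFibre` (Thm. 3.3.1 for `k`-smooth generic fibres) of its proof
cone in the tree. Kept in a separate file so that `ValuativeTorsorToLurel.lean` does not import
the Temkin cone.
-/

noncomputable section

set_option linter.dupNamespace false -- mandated namespace of this single-conjunct summit

open Literature.AlgebraicGeometry.Resolution

namespace Summit.ResolutionOfSingularities.ResolutionOfSingularities.Theorems

/-- **The crux modulo Temkin's theorem** (CONDITIONAL on the named Literature fact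
`Temkin2013Relative` = Temkin 2013, arXiv:0804.1554v3, Thm. 1.3.2, relative form, corrected
rendering): local uniformization of `α_p`-torsors over regular bases implies relative local
uniformization over EVERY ground field of characteristic `p`. -/
theorem torsorToLurel_of_temkin2013Relative (hTem : Temkin2013Relative.{0}) :
    Summit.ResolutionOfSingularities.ResolutionOfSingularities.Theses.Valuative.TorsorToLurel :=
  torsorToLurel_of_torsorToLurelFfinite (torsorToLurelFfinite_of_temkin2013Relative hTem)

/-- The same, CONDITIONAL on the single remaining leaf of the tree's proof cone of Temkin's
theorem, `Temkin2013RelativeCurveSmoothFibre` (Temkin 2013, Thm. 3.3.1 for `k`-smooth generic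
fibres), via the in-tree reduction `torsorToLurelFfinite_of_smoothFibre`. -/
theorem torsorToLurel_of_smoothFibre (hsf : Temkin2013RelativeCurveSmoothFibre.{0}) :
    Summit.ResolutionOfSingularities.ResolutionOfSingularities.Theses.Valuative.TorsorToLurel :=
  torsorToLurel_of_torsorToLurelFfinite (torsorToLurelFfinite_of_smoothFibre hsf)

end Summit.ResolutionOfSingularities.ResolutionOfSingularities.Theorems

end
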